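import Summits.Parity.GeneralizedHardyLittlewood.Theorems.LeeYangFibresFibrationLemmaDisc
import Summits.Parity.GeneralizedHardyLittlewood.Theorems.LeeYangFibresFibrationLemmaEqui
import Literature.NumberTheory.Sieve.LinearEquationsInPrimesWTrick
import Literature.NumberTheory.Sieve.LinearEquationsInPrimesMultiplicativity
import Literature.NumberTheory.Sieve.LinearEquationsInPrimesDimOne
import HarnessLib

/-!
# Fibration lemma (`DimOne → GeneralizedHardyLittlewood`): fibre sums, fibre lengths and the CRT head

Support file for the statement item `FibrationLemma : DimOne → GeneralizedHardyLittlewood`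
(stmt-Parity-0822, shared; here for route `LeeYangFibres`, whose `Assembly` (stmt-Parity-14612) composes
through it). A system `Ψ` on `ℤ^{d+1}` with all last coefficients `aᵢ ≠ 0` is fibred over its first `d`
coordinates (`…FibrationLemmaDefs`: fibre systems `Φ_w`, fibre bodies `K_w`; `…Disc`: good / bad base
points; `…Equi`: equidistribution of periodic weights). Green–Tao's remark after Conj. 1.2 ("holding
`d − 1` of the variables fixed and summing in the remaining one") then splits into a LEFT half, done here,

  `|∑_{n ∈ K ∩ ℤ^{d+1}} ∏ᵢ Λ(ψᵢ(n)) − ∑_{w good} β_∞(Φ_w, K_w) ∏_p β_p(Φ_w)| ≤ ε N^{d+1}`   (`fibreSums_estimate`: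
  `DimOne` — an explicit hypothesis in unfolded form, so any route's `DimOne` fits — on the `≤ (2N+1)^d`
  good fibres, uniformly; the `≤ t²(2N+1)^{d-1}` bad fibres are `O((2N+1) log^t N)` each,
  `fibre_vonMangoldtSum_le`, and `o(N^{d+1})` in total, tree `slab_error_eventually`),

and a RIGHT half `∑_{w good} β_∞(Φ_w, K_w) ∏_p β_p(Φ_w) = β_∞(Ψ, K) ∏_p β_p(Ψ) + o(N^{d+1})` (fibre-length
weighted averaging of the fibre singular products; parts 4–6 `…MinFactor`, `…Equi`, `…Tail` of the
fibration files), of which this file records the two parameter-free steps: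

* the HEAD (CRT), immediate from the tree's multiplicativity `β_W = ∏_{p ≤ z} β_p`, `W = ∏_{p ≤ z} p`
  (`localFactor_primorial`): `singularProductPartial_fibreSystem_congr` (`∏_{p ≤ z} β_p(Φ_w)` is
  `W`-periodic in `w`), `avg_singularProductPartial_fibreSystem` (`𝔼_{r ∈ (ℤ/W)^d} ∏_{p≤z} β_p(Φ_r) =
  ∏_{p≤z} β_p(Ψ)`), `abs_sum_head_sub_volume_mul_le` (with part 5's equidistribution);
* FIBRE LENGTHS: `abs_card_sub_archFactor_le_one` (`β_∞(Φ_w, K_w)` is the lattice count of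
  `K_w ∩ {Φ_w > 0}` up to `1`, tree `DimOne.exists_filter_eq_Icc`), `abs_sum_mul_archFactor_sub_sum_le`
  (fibre-length weighted sums are lattice sums over `K ∩ {Ψ > 0}` up to `(2N+1)^d F_max`), and the
  packaged HEAD MAIN TERM `abs_sum_head_mul_archFactor_sub_le`:
  `|∑_w (∏_{p≤z} β_p(Φ_w)) β_∞(Φ_w, K_w) − β_∞(Ψ, K) ∏_{p≤z} β_p(Ψ)| ≤ H_max (W^d (d+1) 4^d (2N)^d + (2N+1)^d)`.

NOT done here: the tails (`∏_{p > z}`), the passage `x → ∞`, the choice `z = z(N)`; with them, this file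
and the lift `LeeYangFibresFibrationLemmaLift` the fibration lemma follows.

References: B. Green, T. Tao, *Linear equations in primes*, Ann. of Math. 171 (2010), §1 (Conj. 1.2, the
remark following it, (1.4), (1.6)), §4 ("estimating `Λ` crudely by `log N`"), App. A [GreenTao2010].
No named facts are used.
-/

noncomputable section

open Finset MeasureTheory

namespace Summit.Parity.GeneralizedHardyLittlewood.Theorems.FibrationFibreSums

open Literature.NumberTheory.Sieve

variable {d t : ℕ}

/-! ### Size bounds -/

/-- `‖Ψ‖_N ≤ L` bounds the constants: `|ψᵢ(0)| ≤ L N` (`N ≥ 1`). [cite: GreenTao2010, (1.1)] -/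
theorem natAbs_const_le_of_affLinSize_le {Ψ : Fin t → AffLinForm d} {N L : ℕ} (hN : 1 ≤ N)
    (h : affLinSize Ψ N ≤ L) (i : Fin t) : ((Ψ i).const).natAbs ≤ L * N := by
  have hN0 : (0 : ℝ) < N := by exact_mod_cast hN
  have h1 : |((Ψ i).const : ℝ) / N| ≤ ∑ i', |((Ψ i').const : ℝ) / N| :=
    Finset.single_le_sum (f := fun i' => |((Ψ i').const : ℝ) / N|) (fun _ _ => abs_nonneg _)
      (Finset.mem_univ i)
  have h2 : ∑ i', |((Ψ i').const : ℝ) / N| ≤ affLinSize Ψ N :=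
    le_add_of_nonneg_left (Finset.sum_nonneg fun _ _ => Finset.sum_nonneg fun _ _ => abs_nonneg _)
  have h3 : |((Ψ i).const : ℝ)| ≤ L * N := by
    have := h1.trans (h2.trans h)
    rwa [abs_div, abs_of_pos hN0, div_le_iff₀ hN0] at this
  have h4 : (((Ψ i).const.natAbs : ℕ) : ℝ) ≤ ((L * N : ℕ) : ℝ) := by
    rw [Nat.cast_natAbs, Int.cast_abs]
    push_cast
    exact h3
  exact_mod_cast h4

open Classical in
/-- **Crude bound on a fibre sum**: for `w ∈ [-N,N]^d`, `|ψ̇ᵢ(e_j)| ≤ L`, `|ψᵢ(0)| ≤ L N`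
(`L, N, t ≥ 1`), the prime sum of the fibre system over the fibre body satisfies
`0 ≤ Σ(Φ_w, K_w) ≤ (2N+1) · log^t(2 L₁ N)` with `L₁ = t (d+2) L` ("estimating `Λ` crudely by
`log N`"; `‖Φ_w‖_N ≤ L₁`). [cite: GreenTao2010, §4 (Elimination of the archimedean factor)] -/
theorem fibre_vonMangoldtSum_le {Ψ : Fin t → AffLinForm (d + 1)} {L N : ℕ} (ht : 1 ≤ t) (hN : 1 ≤ N)
    (hL1 : 1 ≤ L) (hL : ∀ i j, ((Ψ i).coeff j).natAbs ≤ L) (hc : ∀ i, (Ψ i).const.natAbs ≤ L * N)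
    {w : Fin d → ℤ} (hw : w ∈ latticeBox d N) (K : Set (Fin (d + 1) → ℝ)) :
    0 ≤ vonMangoldtSum (fibreSystem Ψ w) (fibreBody K (realPoint w)) N ∧
      vonMangoldtSum (fibreSystem Ψ w) (fibreBody K (realPoint w)) N ≤
        (2 * N + 1) * Real.log (2 * ((t * (d + 2) * L : ℕ) : ℝ) * N) ^ t := by
  have hsize : affLinSize (fibreSystem Ψ w) N ≤ ((t * (d + 2) * L : ℕ) : ℝ) :=
    affLinSize_fibreSystem_le hN hL hc hw
  have hL₁ : (1 : ℝ) ≤ ((t * (d + 2) * L : ℕ) : ℝ) := by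
    exact_mod_cast (show 1 * 1 * 1 ≤ t * (d + 2) * L from
      Nat.mul_le_mul (Nat.mul_le_mul ht (by omega)) hL1)
  unfold vonMangoldtSum
  set S := (latticeBox 1 N).filter (fun n => realPoint n ∈ fibreBody K (realPoint w)) with hS
  have hterm : ∀ n ∈ S, 0 ≤ ∏ i, intVonMangoldt ((fibreSystem Ψ w i).eval n) ∧
      ∏ i, intVonMangoldt ((fibreSystem Ψ w i).eval n) ≤
        Real.log (2 * ((t * (d + 2) * L : ℕ) : ℝ) * N) ^ t := fun n hn =>
    prod_intVonMangoldt_le hN hL₁ hsize (Finset.mem_filter.mp hn).1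
  refine ⟨Finset.sum_nonneg fun n hn => (hterm n hn).1, ?_⟩
  calc ∑ n ∈ S, ∏ i, intVonMangoldt ((fibreSystem Ψ w i).eval n)
      ≤ ∑ _n ∈ S, Real.log (2 * ((t * (d + 2) * L : ℕ) : ℝ) * N) ^ t :=
        Finset.sum_le_sum fun n hn => (hterm n hn).2
    _ = #S * Real.log (2 * ((t * (d + 2) * L : ℕ) : ℝ) * N) ^ t := by
        rw [Finset.sum_const, nsmul_eq_mul]
    _ ≤ (2 * N + 1) * Real.log (2 * ((t * (d + 2) * L : ℕ) : ℝ) * N) ^ t := by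
        refine mul_le_mul_of_nonneg_right ?_ (pow_nonneg (Real.log_nonneg ?_) _)
        · have h1 : #S ≤ #(latticeBox 1 N) := Finset.card_filter_le _ _
          rw [card_latticeBox, pow_one] at h1
          exact_mod_cast h1
        · have : (1 : ℝ) ≤ N := by exact_mod_cast hN
          nlinarith

/-! ### The fibre sums -/

/-- **`DimOne` on the good fibres.** Under the one-dimensional conjecture (hypothesis `hDim`, the
common unfolding of the routes' `DimOne`), for `d, t ≥ 1`, uniformly over non-degenerate `Ψ` on `ℤ^{d+1}`
(`‖Ψ‖_N ≤ L`, all last coefficients non-zero) and convex `K ⊆ [-N, N]^{d+1}`: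
`|∑_{n ∈ K ∩ ℤ^{d+1}} ∏ᵢ Λ(ψᵢ(n)) − ∑_{w ∈ goodSet} β_∞(Φ_w, K_w) ∏_p β_p(Φ_w)| ≤ ε N^{d+1}` for `N ≥ N₀`
(fibre the sum, `vonMangoldtSum_eq_sum_fibre`; `DimOne` on the `≤ (2N+1)^d` good fibres with
`‖Φ_w‖_N ≤ t(d+2)L` and tolerance `ε/(2·3^d)`; the `≤ t²(2N+1)^{d-1}` bad fibres give
`≤ t²(2N+1)^d log^t(2t(d+2)LN) ≤ (ε/2) N^{d+1}`). [cite: GreenTao2010, §1 (remark after Conj. 1.2)] -/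
theorem fibreSums_estimate
    (hDim : ∀ (t L : ℕ), 1 ≤ t → ∀ ε : ℝ, 0 < ε → ∃ N₀ : ℕ, ∀ N : ℕ, N₀ ≤ N →
      ∀ Φ : Fin t → AffLinForm 1, IsNondegenerateSystem Φ → affLinSize Φ N ≤ L →
        ∀ K : Set (Fin 1 → ℝ), Convex ℝ K → K ⊆ realBox 1 N →
          |vonMangoldtSum Φ K N - archFactor Φ K * singularProduct Φ| ≤ ε * (N : ℝ))
    (d t L : ℕ) (hd : 1 ≤ d) (ht : 1 ≤ t) (ε : ℝ) (hε : 0 < ε) :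
    ∃ N₀ : ℕ, ∀ N : ℕ, N₀ ≤ N →
      ∀ Ψ : Fin t → AffLinForm (d + 1), IsNondegenerateSystem Ψ → (∀ i, lastCoeff (Ψ i) ≠ 0) →
        affLinSize Ψ N ≤ L → ∀ K : Set (Fin (d + 1) → ℝ), Convex ℝ K → K ⊆ realBox (d + 1) N →
          |vonMangoldtSum Ψ K N -
              ∑ w ∈ goodSet Ψ N, archFactor (fibreSystem Ψ w) (fibreBody K (realPoint w)) *
                singularProduct (fibreSystem Ψ w)| ≤ ε * (N : ℝ) ^ (d + 1) := by
  -- constants: `L₊ = max L 1`, `L₁ = t (d+2) L₊`, `ε₁ = ε / (2·3^d)`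
  set Lp : ℕ := max L 1 with hLp
  have hLp1 : 1 ≤ Lp := le_max_right _ _
  have hLLp : L ≤ Lp := le_max_left _ _
  set L₁ : ℕ := t * (d + 2) * Lp with hL₁
  set ε₁ : ℝ := ε / (2 * 3 ^ d) with hε₁
  have hε₁pos : 0 < ε₁ := by rw [hε₁]; positivity
  obtain ⟨N_D, hN_D⟩ := hDim t L₁ ht ε₁ hε₁pos
  -- the bad fibres are `o(N^{d+1})`
  have hA : (1 : ℝ) ≤ (t : ℝ) * t := by nlinarith [(show (1 : ℝ) ≤ t by exact_mod_cast ht)]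
  have hL₁one : (1 : ℝ) ≤ (L₁ : ℝ) := by
    exact_mod_cast (show 1 * 1 * 1 ≤ t * (d + 2) * Lp from
      Nat.mul_le_mul (Nat.mul_le_mul ht (by omega)) hLp1)
  obtain ⟨N_B, hN_B⟩ := slab_error_eventually hA hL₁one (half_pos hε) (d + 1) t (by omega)
  refine ⟨max (max N_D N_B) 1, fun N hN Ψ hΨ ha hΨL K hK hKN => ?_⟩
  have hN1 : 1 ≤ N := le_of_max_le_right hN
  have hND : N_D ≤ N := (le_max_left _ _).trans (le_of_max_le_left hN)
  have hNB : N_B ≤ N := (le_max_right _ _).trans (le_of_max_le_left hN)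
  -- coefficient and constant bounds
  have hΨLp : affLinSize Ψ N ≤ (Lp : ℝ) := hΨL.trans (by exact_mod_cast hLLp)
  have hcoef : ∀ i j, ((Ψ i).coeff j).natAbs ≤ Lp := fun i j => natAbs_coeff_le_of_affLinSize_le hΨLp i j
  have hconst : ∀ i, (Ψ i).const.natAbs ≤ Lp * N := fun i => natAbs_const_le_of_affLinSize_le hN1 hΨLp i
  -- abbreviations
  set Sw : (Fin d → ℤ) → ℝ := fun w => vonMangoldtSum (fibreSystem Ψ w) (fibreBody K (realPoint w)) N
  set Mw : (Fin d → ℤ) → ℝ := fun w =>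
    archFactor (fibreSystem Ψ w) (fibreBody K (realPoint w)) * singularProduct (fibreSystem Ψ w)
  -- fibre the sum and split good/bad
  have hsplit : vonMangoldtSum Ψ K N = ∑ w ∈ goodSet Ψ N, Sw w + ∑ w ∈ badSet Ψ N, Sw w := by
    rw [vonMangoldtSum_eq_sum_fibre, sum_latticeBox_eq_sum_goodSet_add_sum_badSet Ψ N]
  -- good fibres: `DimOne`
  have hgood : ∀ w ∈ goodSet Ψ N, |Sw w - Mw w| ≤ ε₁ * N := by
    intro w hw
    have hwbox : w ∈ latticeBox d N := goodSet_subset Ψ N hw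
    exact hN_D N hND (fibreSystem Ψ w) (isNondegenerateSystem_of_mem_goodSet ha hw)
      (affLinSize_fibreSystem_le hN1 hcoef hconst hwbox) (fibreBody K (realPoint w))
      (convex_fibreBody hK (realPoint w)) (fibreBody_subset_realBox hKN (realPoint w))
  have hgood_sum : |∑ w ∈ goodSet Ψ N, Sw w - ∑ w ∈ goodSet Ψ N, Mw w| ≤ ε / 2 * (N : ℝ) ^ (d + 1) := by
    rw [← Finset.sum_sub_distrib]
    calc |∑ w ∈ goodSet Ψ N, (Sw w - Mw w)| ≤ ∑ w ∈ goodSet Ψ N, |Sw w - Mw w| :=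
          Finset.abs_sum_le_sum_abs _ _
      _ ≤ ∑ _w ∈ goodSet Ψ N, ε₁ * N := Finset.sum_le_sum hgood
      _ = #(goodSet Ψ N) * (ε₁ * N) := by rw [Finset.sum_const, nsmul_eq_mul]
      _ ≤ (2 * N + 1) ^ d * (ε₁ * N) := by
          refine mul_le_mul_of_nonneg_right ?_ (by positivity)
          exact_mod_cast card_goodSet_le Ψ N
      _ ≤ (3 * N) ^ d * (ε₁ * N) := by
          refine mul_le_mul_of_nonneg_right (pow_le_pow_left₀ (by positivity) ?_ _) (by positivity)
          have : (1 : ℝ) ≤ N := by exact_mod_cast hN1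
          linarith
      _ = ε / 2 * (N : ℝ) ^ (d + 1) := by
          rw [hε₁, mul_pow, pow_succ]
          field_simp
  -- bad fibres: crude bound
  have hbad_each : ∀ w ∈ badSet Ψ N, 0 ≤ Sw w ∧ Sw w ≤ (2 * N + 1) * Real.log (2 * (L₁ : ℝ) * N) ^ t := by
    intro w hw
    simpa only [hL₁] using fibre_vonMangoldtSum_le ht hN1 hLp1 hcoef hconst (badSet_subset Ψ N hw) K
  have hbad_sum : 0 ≤ ∑ w ∈ badSet Ψ N, Sw w ∧
      ∑ w ∈ badSet Ψ N, Sw w ≤ ε / 2 * (N : ℝ) ^ (d + 1) := by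
    refine ⟨Finset.sum_nonneg fun w hw => (hbad_each w hw).1, ?_⟩
    have hlog0 : 0 ≤ Real.log (2 * (L₁ : ℝ) * N) :=
      Real.log_nonneg (by nlinarith [(show (1 : ℝ) ≤ N by exact_mod_cast hN1)])
    calc ∑ w ∈ badSet Ψ N, Sw w ≤ ∑ _w ∈ badSet Ψ N, (2 * N + 1) * Real.log (2 * (L₁ : ℝ) * N) ^ t :=
          Finset.sum_le_sum fun w hw => (hbad_each w hw).2
      _ = #(badSet Ψ N) * ((2 * N + 1) * Real.log (2 * (L₁ : ℝ) * N) ^ t) := by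
          rw [Finset.sum_const, nsmul_eq_mul]
      _ ≤ (t * t * (2 * N + 1) ^ (d - 1) : ℕ) * ((2 * N + 1) * Real.log (2 * (L₁ : ℝ) * N) ^ t) := by
          refine mul_le_mul_of_nonneg_right ?_ (by positivity)
          exact_mod_cast card_badSet_le hΨ ha N
      _ = (t : ℝ) * t * (2 * N + 1) ^ d * Real.log (2 * (L₁ : ℝ) * N) ^ t := by
          obtain ⟨d', rfl⟩ : ∃ d', d = d' + 1 := ⟨d - 1, by omega⟩
          rw [Nat.add_sub_cancel]
          push_cast
          ring
      _ ≤ (t : ℝ) * t * (((t : ℝ) * t * N) ^ ((8 : ℝ) / 10) + 1) * (2 * N + 1) ^ (d + 1 - 1) *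
            (1 + Real.log (2 * (L₁ : ℝ) * N)) ^ t := by
          rw [Nat.add_sub_cancel]
          have h1 : (1 : ℝ) ≤ ((t : ℝ) * t * N) ^ ((8 : ℝ) / 10) + 1 := by
            linarith [(by positivity : 0 ≤ ((t : ℝ) * t * N) ^ ((8 : ℝ) / 10))]
          have h2 : Real.log (2 * (L₁ : ℝ) * N) ^ t ≤ (1 + Real.log (2 * (L₁ : ℝ) * N)) ^ t :=
            pow_le_pow_left₀ hlog0 (by linarith) _
          have h3 : 0 ≤ (t : ℝ) * t * (2 * N + 1) ^ d := by positivity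
          calc (t : ℝ) * t * (2 * N + 1) ^ d * Real.log (2 * (L₁ : ℝ) * N) ^ t
              = ((t : ℝ) * t * (2 * N + 1) ^ d) * 1 * Real.log (2 * (L₁ : ℝ) * N) ^ t := by ring
            _ ≤ ((t : ℝ) * t * (2 * N + 1) ^ d) * (((t : ℝ) * t * N) ^ ((8 : ℝ) / 10) + 1) *
                  (1 + Real.log (2 * (L₁ : ℝ) * N)) ^ t :=
                mul_le_mul (mul_le_mul_of_nonneg_left h1 h3) h2 (pow_nonneg hlog0 _) (by positivity)
            _ = _ := by ring
      _ ≤ ε / 2 * (N : ℝ) ^ (d + 1) := hN_B N hNB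
  -- combine
  rw [hsplit]
  have key : (∑ w ∈ goodSet Ψ N, Sw w + ∑ w ∈ badSet Ψ N, Sw w) - ∑ w ∈ goodSet Ψ N, Mw w =
      (∑ w ∈ goodSet Ψ N, Sw w - ∑ w ∈ goodSet Ψ N, Mw w) + ∑ w ∈ badSet Ψ N, Sw w := by ring
  rw [key]
  calc |(∑ w ∈ goodSet Ψ N, Sw w - ∑ w ∈ goodSet Ψ N, Mw w) + ∑ w ∈ badSet Ψ N, Sw w|
      ≤ |∑ w ∈ goodSet Ψ N, Sw w - ∑ w ∈ goodSet Ψ N, Mw w| + |∑ w ∈ badSet Ψ N, Sw w| :=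
        abs_add_le _ _
    _ ≤ ε / 2 * (N : ℝ) ^ (d + 1) + ε / 2 * (N : ℝ) ^ (d + 1) := by
        refine add_le_add hgood_sum ?_
        rw [abs_of_nonneg hbad_sum.1]
        exact hbad_sum.2
    _ = ε * (N : ℝ) ^ (d + 1) := by ring

/-! ### The head of the fibre singular products (CRT) -/

/-- **The head of the fibre singular products is `primorial z`-periodic**: `∏_{p ≤ z} β_p(Φ_w)`
depends only on `w mod W`, `W = ∏_{p ≤ z} p` (it is `β_W(Φ_w)`, tree: `localFactor_primorial`).
[cite: GreenTao2010, (1.6) and the following sentence] -/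
theorem singularProductPartial_fibreSystem_congr (Ψ : Fin t → AffLinForm (d + 1)) (z : ℕ)
    {w w' : Fin d → ℤ} (h : ∀ j, ((w j : ℤ) : ZMod (primorial z)) = w' j) :
    singularProductPartial (fibreSystem Ψ w) z = singularProductPartial (fibreSystem Ψ w') z := by
  haveI : NeZero (primorial z) := ⟨primorial_ne_zero z⟩
  rw [← localFactor_primorial, ← localFactor_primorial]
  exact localFactor_fibreSystem_congr Ψ h

/-- **CRT head**: the average over the base residues `r mod W` (`W = ∏_{p ≤ z} p`) of the heads
`∏_{p ≤ z} β_p(Φ_r)` of the fibre singular products is the head `∏_{p ≤ z} β_p(Ψ)` of the singular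
product of `Ψ` — by multiplicativity `∏_{p ≤ z} β_p = β_W` (CRT, tree: `localFactor_primorial`) and
`β_W(Ψ) = 𝔼_{r ∈ (ℤ/W)^d} β_W(Φ_r)` (`localFactor_eq_avg_fibre`).
[cite: GreenTao2010, (1.6) and the following sentence] -/
theorem avg_singularProductPartial_fibreSystem (Ψ : Fin t → AffLinForm (d + 1)) (z : ℕ) :
    (((primorial z : ℕ) : ℝ) ^ d)⁻¹ *
        ∑ r ∈ Fintype.piFinset (fun _ : Fin d => range (primorial z)),
          singularProductPartial (fibreSystem Ψ fun j => (r j : ℤ)) z =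
      singularProductPartial Ψ z := by
  simp only [← localFactor_primorial]
  exact (localFactor_eq_avg_fibre Ψ (primorial_ne_zero z)).symm

open Classical in
/-- **Head plus equidistribution**: for a convex `K ⊆ [-N,N]^{d+1}` (`N ≥ 1`) and a bound
`H_max ≥ |∏_{p ≤ z} β_p(Φ_w)|` valid for all `w`,
`|∑_{n ∈ K ∩ ℤ^{d+1}} ∏_{p ≤ z} β_p(Φ_{(n₁,…,n_d)}) − vol(K) ∏_{p ≤ z} β_p(Ψ)| ≤ H_max W^d (d+1) 4^d (2N)^d`,
`W = ∏_{p ≤ z} p` (tree: `abs_sum_periodic_sub_volume_mul_le` with the CRT head).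
[cite: GreenTao2010, §1 (remark after Conj. 1.2) and App. A] -/
theorem abs_sum_head_sub_volume_mul_le (Ψ : Fin t → AffLinForm (d + 1)) (z : ℕ) {N : ℕ} (hN : 1 ≤ N)
    {K : Set (Fin (d + 1) → ℝ)} (hK : Convex ℝ K) (hKN : K ⊆ realBox (d + 1) N) {Hmax : ℝ}
    (hH : ∀ w : Fin d → ℤ, |singularProductPartial (fibreSystem Ψ w) z| ≤ Hmax) :
    |∑ n ∈ (latticeBox (d + 1) N).filter (fun n => realPoint n ∈ K),
        singularProductPartial (fibreSystem Ψ (Fin.init n)) z -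
        (volume K).toReal * singularProductPartial Ψ z| ≤
      Hmax * ((primorial z : ℕ) : ℝ) ^ d * (((d : ℝ) + 1) * 4 ^ d * ((2 * N : ℕ) : ℝ) ^ d) := by
  have h := abs_sum_periodic_sub_volume_mul_le (d := d) (primorial z) (primorial_pos z) hN hK hKN
    (fun w => singularProductPartial (fibreSystem Ψ w) z)
    (fun w w' hww' => singularProductPartial_fibreSystem_congr Ψ z hww') hH
  rwa [avg_singularProductPartial_fibreSystem] at h

/-! ### Fibre lengths versus lattice points of the fibres -/

open Classical in
/-- **A fibre length is a lattice count up to `1`**: for a `d = 1` system `Φ` and a convex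
`K₁ ⊆ [-N, N]`, the number of lattice points of `K₁ ∩ {Φ > 0}` differs from its length
`β_∞(Φ, K₁)` by at most `1` (the positive part is an interval; tree: `DimOne.exists_filter_eq_Icc`).
[cite: GreenTao2010, (1.4) and App. A] -/
theorem abs_card_sub_archFactor_le_one (Φ : Fin t → AffLinForm 1) {N : ℕ} {K₁ : Set (Fin 1 → ℝ)}
    (hK : Convex ℝ K₁) (hKN : K₁ ⊆ realBox 1 N) :
    |(#((latticeBox 1 N).filter (fun n => realPoint n ∈ posBody Φ 0 K₁)) : ℝ) - archFactor Φ K₁| ≤ 1 := by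
  set S : Set ℝ := {r : ℝ | (fun _ : Fin 1 => r) ∈ K₁ ∧ ∀ i, 0 < (Φ i).realEval (fun _ => r)} with hS
  have harch : archFactor Φ K₁ = (volume S).toReal := DimOne.archFactor_eq Φ K₁
  -- `S` is an interval inside `[-N, N]`
  have hSconv : Convex ℝ S := by
    have h1 : Convex ℝ {r : ℝ | (fun _ : Fin 1 => r) ∈ K₁} := DimOne.convex_slice hK
    have h2 : ∀ i, Convex ℝ {r : ℝ | 0 < (Φ i).realEval (fun _ => r)} := fun i => by
      have : {r : ℝ | 0 < (Φ i).realEval (fun _ => r)} =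
          {r : ℝ | 0 < ((Φ i).coeff 0 : ℝ) * r + (Φ i).const} := by
        ext r; simp [DimOne.realEval_eq]
      rw [this]; exact DimOne.convex_setOf_pos _ _
    have : S = {r : ℝ | (fun _ : Fin 1 => r) ∈ K₁} ∩ ⋂ i, {r : ℝ | 0 < (Φ i).realEval (fun _ => r)} := by
      ext r; simp [hS]
    rw [this]
    exact h1.inter (convex_iInter h2)
  have hSN : S ⊆ Set.Icc (-(N : ℝ)) N := by
    intro r hr
    have h := hKN hr.1
    simp only [realBox, Set.mem_Icc, Pi.le_def] at h
    exact ⟨h.1 0, h.2 0⟩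
  obtain ⟨m₁, m₂, hI, hvol⟩ := DimOne.exists_filter_eq_Icc (N := N) hSconv.ordConnected hSN
  -- the lattice points of `K₁ ∩ {Φ > 0}` are the integers of `S`
  have hcard : #((latticeBox 1 N).filter (fun n => realPoint n ∈ posBody Φ 0 K₁)) =
      #((Finset.Icc (-(N : ℤ)) N).filter (fun m : ℤ => ((m : ℤ) : ℝ) ∈ S)) := by
    rw [DimOne.card_filter_latticeBox]
    congr 1
    refine Finset.filter_congr fun m _ => ?_
    simp only [posBody, Set.mem_inter_iff, Set.mem_setOf_eq, hS, DimOne.realPoint_const]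
  rw [hcard, hI, harch]
  exact hvol

open Classical in
/-- **Fibre-length weighted sums are lattice sums up to `O(N^d)`**: for `K ⊆ [-N,N]^{d+1}` convex and
`|F| ≤ F_max` on the base points,
`|∑_{w ∈ [-N,N]^d} F(w) β_∞(Φ_w, K_w) − ∑_{n ∈ K ∩ {Ψ > 0} ∩ ℤ^{d+1}} F(n₁, …, n_d)| ≤ (2N+1)^d F_max`
(the lattice points of `K ∩ {Ψ > 0}` over `w` are those of `K_w ∩ {Φ_w > 0}`, counted by
`β_∞(Φ_w, K_w) ± 1`). [cite: GreenTao2010, §1 (remark after Conj. 1.2) and App. A] -/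
theorem abs_sum_mul_archFactor_sub_sum_le (Ψ : Fin t → AffLinForm (d + 1)) {N : ℕ}
    {K : Set (Fin (d + 1) → ℝ)} (hK : Convex ℝ K) (hKN : K ⊆ realBox (d + 1) N)
    (F : (Fin d → ℤ) → ℝ) {Fmax : ℝ} (hF : ∀ w, |F w| ≤ Fmax) :
    |∑ w ∈ latticeBox d N, F w * archFactor (fibreSystem Ψ w) (fibreBody K (realPoint w)) -
        ∑ n ∈ (latticeBox (d + 1) N).filter (fun n => realPoint n ∈ posBody Ψ 0 K), F (Fin.init n)| ≤
      (2 * N + 1) ^ d * Fmax := by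
  -- the lattice sum, fibred
  have hfib : ∑ n ∈ (latticeBox (d + 1) N).filter (fun n => realPoint n ∈ posBody Ψ 0 K), F (Fin.init n) =
      ∑ w ∈ latticeBox d N, F w *
        #((latticeBox 1 N).filter (fun n => realPoint n ∈
          posBody (fibreSystem Ψ w) 0 (fibreBody K (realPoint w)))) := by
    rw [sum_filter_latticeBox_succ]
    refine Finset.sum_congr rfl fun w _ => ?_
    have hinit : ∀ m : ℤ, F (Fin.init (Fin.snoc w m : Fin (d + 1) → ℤ)) = F w := fun m => by
      rw [Fin.init_snoc]
    simp only [hinit]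
    rw [Finset.sum_const, nsmul_eq_mul, mul_comm]
    congr 2
    rw [DimOne.card_filter_latticeBox]
    congr 1
    refine Finset.filter_congr fun m _ => ?_
    simp only [posBody, Set.mem_inter_iff, Set.mem_setOf_eq, mem_fibreBody, realPoint_snoc,
      DimOne.realPoint_const, fibreSystem, fibreForm_realEval, realEval_snoc, baseForm_realEval_realPoint]
  rw [hfib, ← Finset.sum_sub_distrib]
  calc |∑ w ∈ latticeBox d N, (F w * archFactor (fibreSystem Ψ w) (fibreBody K (realPoint w)) -
          F w * #((latticeBox 1 N).filter (fun n => realPoint n ∈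
            posBody (fibreSystem Ψ w) 0 (fibreBody K (realPoint w)))))|
      ≤ ∑ w ∈ latticeBox d N, |F w * archFactor (fibreSystem Ψ w) (fibreBody K (realPoint w)) -
          F w * #((latticeBox 1 N).filter (fun n => realPoint n ∈
            posBody (fibreSystem Ψ w) 0 (fibreBody K (realPoint w))))| := Finset.abs_sum_le_sum_abs _ _
    _ ≤ ∑ _w ∈ latticeBox d N, Fmax := Finset.sum_le_sum fun w _ => by
        rw [← mul_sub, abs_mul]
        have h1 := abs_card_sub_archFactor_le_one (fibreSystem Ψ w) (N := N)
          (convex_fibreBody hK (realPoint w)) (fibreBody_subset_realBox hKN (realPoint w))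
        rw [abs_sub_comm] at h1
        calc |F w| * |archFactor (fibreSystem Ψ w) (fibreBody K (realPoint w)) -
              #((latticeBox 1 N).filter (fun n => realPoint n ∈
                posBody (fibreSystem Ψ w) 0 (fibreBody K (realPoint w))))|
            ≤ Fmax * 1 := mul_le_mul (hF w) h1 (abs_nonneg _) ((abs_nonneg _).trans (hF w))
          _ = Fmax := mul_one _
    _ = (2 * N + 1) ^ d * Fmax := by
        rw [Finset.sum_const, nsmul_eq_mul, card_latticeBox]
        push_cast
        ring

/-! ### The head main term -/

open Classical in
/-- **The head main term.** For `K ⊆ [-N,N]^{d+1}` convex (`N ≥ 1`), `z ≥ 0`, `W = ∏_{p ≤ z} p`, and a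
bound `H_max ≥ |∏_{p ≤ z} β_p(Φ_w)|` valid for all `w`: the fibre-length weighted sum of the heads of the
fibre singular products is the archimedean factor of `Ψ` times the head of its singular product, up to
`O(H_max W^d N^d)`:
`|∑_{w ∈ [-N,N]^d} (∏_{p ≤ z} β_p(Φ_w)) β_∞(Φ_w, K_w) − β_∞(Ψ, K) ∏_{p ≤ z} β_p(Ψ)| ≤ H_max (W^d (d+1) 4^d (2N)^d + (2N+1)^d)`
(fibre lengths → lattice points of `K ∩ {Ψ > 0}`, equidistribution of the `W`-periodic head, CRT head,
`vol(K ∩ {Ψ > 0}) = β_∞(Ψ, K)`). [cite: GreenTao2010, §1 (remark after Conj. 1.2) and App. A] -/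
theorem abs_sum_head_mul_archFactor_sub_le (Ψ : Fin t → AffLinForm (d + 1)) (z : ℕ) {N : ℕ}
    (hN : 1 ≤ N) {K : Set (Fin (d + 1) → ℝ)} (hK : Convex ℝ K) (hKN : K ⊆ realBox (d + 1) N)
    {Hmax : ℝ} (hH : ∀ w : Fin d → ℤ, |singularProductPartial (fibreSystem Ψ w) z| ≤ Hmax) :
    |∑ w ∈ latticeBox d N, singularProductPartial (fibreSystem Ψ w) z *
          archFactor (fibreSystem Ψ w) (fibreBody K (realPoint w)) -
        archFactor Ψ K * singularProductPartial Ψ z| ≤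
      Hmax * (((primorial z : ℕ) : ℝ) ^ d * (((d : ℝ) + 1) * 4 ^ d * ((2 * N : ℕ) : ℝ) ^ d) +
        (2 * N + 1) ^ d) := by
  have hK₀ : Convex ℝ (posBody Ψ 0 K) := convex_posBody Ψ 0 hK
  have hK₀N : posBody Ψ 0 K ⊆ realBox (d + 1) N := (posBody_subset Ψ 0 K).trans hKN
  have h1 := abs_sum_mul_archFactor_sub_sum_le Ψ hK hKN
    (fun w => singularProductPartial (fibreSystem Ψ w) z) hH
  have h2 := abs_sum_head_sub_volume_mul_le Ψ z hN hK₀ hK₀N hH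
  rw [← archFactor_eq_volume_posBody] at h2
  have := (abs_sub_le _ _ _).trans (add_le_add h1 h2)
  linarith [this]

end Summit.Parity.GeneralizedHardyLittlewood.Theorems.FibrationFibreSums
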